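import Summits.ResolutionOfSingularities.ResolutionOfSingularities.Theorems.EquisingularLiftEquisingularLiftNatTowerAssemblyV7
import Summits.ResolutionOfSingularities.ResolutionOfSingularities.Theorems.EquisingularLiftEquisingularLiftNatTowerEmbRoundThree
import Summits.ResolutionOfSingularities.ResolutionOfSingularities.Theorems.EquisingularLiftEquisingularLiftNatTowerRoundFourDefs
import Summits.ResolutionOfSingularities.ResolutionOfSingularities.Theorems.EquisingularLiftEquisingularLiftNatTowerFrameSupply
import Summits.ResolutionOfSingularities.ResolutionOfSingularities.Theorems.EquisingularLiftEquisingularLiftCentreBlowupFlatExceptional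
import Summits.ResolutionOfSingularities.ResolutionOfSingularities.Theorems.EquisingularLiftEquisingularLiftNatCechShadowAny
import Summits.ResolutionOfSingularities.ResolutionOfSingularities.Theorems.EquisingularLiftEquisingularLiftNatCurveOnSurfaceCartier
import Summits.ResolutionOfSingularities.ResolutionOfSingularities.Theorems.EquisingularLiftEquisingularLiftNatCentreCartierPairFrame
import HarnessLib

/-!
# [OURS · L1 W4.5(b) · EL♮(3)] THE EMBEDDED-LIFT ROUND FROM (T-k) AT THE DATUM «`V(𝓔)` IS `O`-FLAT», STAND-IN-FREE — the round brick of the DEF-TOWER₆ engine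

res-L1-w45b-stub-4 g9 (owner of the NINETEENTH plumbing `stub_elnat_defTowerPointResolution`). OURS; NOT a statement of any manuscript; AI-written,
weaker than expert review. No `sorry`; standard axioms; DEF-FREE. `--supports stmt-ResolutionOfSingularities-20148 --as helper`.

`Tower.hCentre_of_fact`: the centre `𝒦₁ := C ⊇ 𝓔` of `EmbeddedCurveLiftAt` ((T-k), res-L1-w45b-lead-2 p594791) with (c1)–(c5) of
`Tower.inv₃_embRound_new/old` (res-L1-w45b-stub-2 …NatTowerEmbRoundThree): exact trace, `O`-flat, regular, (c4) by res-L1-w45b-lead-1's `isEffectiveCartier_comap_subschemeι_of_frames` p597181 («a regular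
curve on the regular Cartier surface `V(𝓔)` is Cartier»; `𝓔` is Cartier as a non-zero locally principal ideal of the integral `X`), 2-frames from
`hFrame_of_ringKrullDim_redSub` (closed points of `Z̃` of dimension 1). Supersedes the stand-in versions of …NatTowerEmbRoundOfFact (p596633).
`Tower.inv₃_embRound_both_of_fact`: the whole round (new AND old surface, side facts of `K′`, the cone-witnessed shadow shape through res-D-pv-029's
GENERIC `Tower.inv₃_coneRound_new/old`) at the tower invariant `Tower.Inv₃ (Ruled := fun … X σ jG 𝓔 => Flat (𝓔.subschemeι ≫ σ ≫ q))`; the datum is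
born by `flat_exceptional_of_isBlowup_regularCentre` and moved along `V(St 𝓔) ≅ V(𝓔)`. (N3-any)/(N3′-any) by res-D-pv-035's `Tower.hShadow_of_any`/`Tower.hShadowOld_of_any` p596860;
`hFact` = (T-k) `EmbeddedCurveLift O k θ P q` is the ONLY hypothesis beyond the V7 context.
-/

set_option linter.dupNamespace false -- mandated namespace `Summit.<Summit>.<Problem>` of this single-conjunct summit
set_option linter.overlappingInstances false -- signatures carry `[IsDomain O] [IsDiscreteValuationRing O]`

noncomputable section

open CategoryTheory CategoryTheory.Limits AlgebraicGeometry TopologicalSpace Topology IsLocalRing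
open Literature.AlgebraicGeometry.Resolution
open AlgebraicGeometry.Scheme.IdealSheafData
open Literature.AlgebraicGeometry.Morphisms (ProjCech.PP ProjCech.toSpec)
open Summit.ResolutionOfSingularities.ResolutionOfSingularities.Theses.EquisingularLift.Split
open Summit.ResolutionOfSingularities.ResolutionOfSingularities.Cruxes.EquisingularLift.StrataSplit

namespace Summit.ResolutionOfSingularities.ResolutionOfSingularities.Cruxes.EquisingularLiftNat.Sections

/-- **The (T-k) centre at a Čech round** — input `hCentre` of `Tower.inv₃_embRound_new/old` at the datum «`V(𝓔)` is `O`-flat»: `𝒦₁ := C ⊇ 𝓔` of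
`EmbeddedCurveLiftAt`, 2-frames from `hFrame_of_ringKrullDim_redSub`, (c4) from lead-1's brick. [OURS · L1 W4.5b]; NOT a statement of the manuscript. -/
theorem Tower.hCentre_of_fact_any (O : Type) [CommRing O] [IsDomain O] [IsDiscreteValuationRing O] (k : Type) [Field k]
    (θ : O →+* k) (hθ : Function.Surjective θ)
    (P : Scheme.{0}) [IsIntegral P] (q : P ⟶ Spec (.of O)) [IsProper q] [SmoothOfRelativeDimension 3 q] (Y : Set P)
    (_hYsp : Y ⊆ q ⁻¹' {IsLocalRing.closedPoint O}) (hYirr : IsIrreducible Y) (hYcl : IsClosed Y)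
    (hPnoeth : IsLocallyNoetherian P) (hPreg : Scheme.IsRegular P)
    (Ch : ∀ X' : Scheme.{0}, (X' ⟶ P) → Set X' → Prop)
    (_hChStep : ∀ (X' X'' : Scheme.{0}) (σ' : X' ⟶ P) (S' : Set X') (C : X'.IdealSheafData) (τ : X'' ⟶ X'),
      Ch X' σ' S' → IsBlowup τ C → Scheme.IsRegular C.subscheme → Flat (C.subschemeι ≫ σ' ≫ q) →
      σ' '' (C.support : Set X') ⊆ {y | ¬ IsGenericPoint y Y} → (C.support : Set X') ∩ (σ' ≫ q) ⁻¹' {IsLocalRing.closedPoint O} ⊆ S' →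
      Ch X'' (τ ≫ σ') (closure (τ ⁻¹' (S' \ (C.support : Set X')))))
    (hChSplit : ∀ (X' : Scheme.{0}) (σ' : X' ⟶ P) (S' : Set X'), Ch X' σ' S' → Chain P Y X' σ' S')
    -- (T-k) the embedded-curve lift at every stage / exceptional surface over `q` (res-L1-w45b-lead-2 …NatTowerRoundFourDefs p594791)
    (hFact : EmbeddedCurveLift O k θ P q)
    -- (S7′) B9 at the `ConeForm` seed with the LOCALIZED shadow trace (vii-loc) (res-type-100: `…NatConeFormConstants` → KCL twin → `hBaseKCL`)
    : ∀ {F₉ : Scheme.{0}} (Z₉ : Set F₉) (hZ₉ : IsClosed Z₉) {F₁₀ : Scheme.{0}} (υ' : F₁₀ ⟶ F₉)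
    (G : Scheme.{0}) (γ : G ⟶ F₁₀) (T E : Set G) (hE : IsClosed E) (Z : Set G) (hZ : IsClosed Z),
    E ≠ Set.univ → Z ⊆ E →
    (∀ x : redSub G Z hZ, IsRegularLocalRing ((redSub G Z hZ).presheaf.stalk x)) →
    (∀ (i : redSub G Z hZ ⟶ redSub G E hE), i ≫ redSubι G E hE = redSubι G Z hZ →
      ∀ x : redSub G Z hZ, IsRegularLocalRing ((redSub G E hE).presheaf.stalk (i x))) →
    DirStepUnobs G E hE Z hZ →
    (∀ z : ↥(redSub G Z hZ), IsClosed ({z} : Set ↥(redSub G Z hZ)) → ringKrullDim ((redSub G Z hZ).presheaf.stalk z) = ((1 : ℕ) : WithBot ℕ∞)) →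
    ∀ (X : Scheme.{0}) (σ : X ⟶ P) (S : Set X) (jG : G ⟶ X) (tG : G ⟶ Spec (.of k)) (𝓔 : X.IdealSheafData),
      Ch X σ S → IsIntegral X → IsLocallyNoetherian X → Scheme.IsRegular X → IsDominant (σ ≫ q) →
      IsPullback jG tG (σ ≫ q) (Spec.map (CommRingCat.ofHom θ)) → jG '' T = S →
      𝓔.comap jG = vanishingIdeal ⟨E, hE⟩ → (∀ z : X, (stalkIdeal 𝓔 z).IsPrincipal) → Scheme.IsRegular 𝓔.subscheme →
      σ '' (𝓔.support : Set X) ⊆ {p : P | ¬ IsGenericPoint p Y} →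
      (fun _ _ _ _ _ _ _ _ _ σ _ 𝓔 => Flat (𝓔.subschemeι ≫ σ ≫ q)) F₉ Z₉ hZ₉ F₁₀ υ' G γ E X σ jG 𝓔 →
      ∃ 𝒦₁ : X.IdealSheafData,
        (𝓔 ⊔ 𝒦₁).comap jG = vanishingIdeal ⟨Z, hZ⟩ ∧ Flat ((𝓔 ⊔ 𝒦₁).subschemeι ≫ σ ≫ q) ∧
        Scheme.IsRegular (𝓔 ⊔ 𝒦₁).subscheme ∧ IsEffectiveCartier (𝒦₁.comap 𝓔.subschemeι) ∧
        (∀ x ∈ (𝓔 ⊔ 𝒦₁).support, ∃ c : Fin 2 → X.presheaf.stalk x,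
          Ideal.span (Set.range c) = stalkIdeal (𝓔 ⊔ 𝒦₁) x ∧ IsQuasiRegular c) := by
  intro F₉ Z₉ hZ₉ F₁₀ υ' G γ T E hE Z hZ hEne hZE hZreg hEZreg hunobs hZdim X σ S jG tG 𝓔 hCh hXint hXnoeth hXreg hdom hsq hTS he_i he_ii
    he_iii _ hFE
  haveI := hXint
  haveI := hXnoeth
  obtain ⟨-, -, hσ⟩ := chain_isRegular P Y X σ S (hChSplit _ _ _ hCh) hPnoeth hPreg
  haveI := hσ
  haveI : IsProper (σ ≫ q) := inferInstance
  have hflatE : Flat (𝓔.subschemeι ≫ σ ≫ q) := hFE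
  have hpropE : IsProper (𝓔.subschemeι ≫ σ ≫ q) := inferInstance
  obtain ⟨C, h𝓔C, hCreg, hCflat, hCtr, -⟩ :=
    hFact X σ 𝓔 hXint hXnoeth hXreg he_iii hflatE hpropE G jG tG hsq E hE he_i Z hZ hZE hZreg hEZreg hunobs
  have hfr : ∀ x ∈ C.support, ∃ c : Fin 2 → X.presheaf.stalk x, Ideal.span (Set.range c) = stalkIdeal C x ∧ IsQuasiRegular c :=
    hFrame_of_ringKrullDim_redSub O k θ hθ P q Y hYirr hYcl hPnoeth hPreg Ch hChSplit T Z hZ hZdim X σ S jG tG C hCh hXint hXnoeth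
      hXreg hdom hsq hTS hCtr hCflat hCreg
  have hsup : 𝓔 ⊔ C = C := sup_eq_right.mpr h𝓔C
  -- (c4) by res-L1-w45b-lead-1's brick: `𝓔` is Cartier (locally principal and non-zero: its trace is `𝓘⟨E⟩` with `E ≠ G`)
  have h𝓔0 : 𝓔 ≠ ⊥ := by
    intro h0
    apply hEne
    have h2 : (((vanishingIdeal ⟨E, hE⟩ : G.IdealSheafData)).support : Set G) = ((⊤ : Closeds G) : Set G) := by
      rw [← he_i, h0, Scheme.IdealSheafData.comap_bot, Scheme.IdealSheafData.support_bot]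
    rwa [Scheme.IdealSheafData.coe_support_vanishingIdeal, Closeds.coe_top] at h2
  have h𝓔cart : IsEffectiveCartier 𝓔 := isEffectiveCartier_of_isPrincipal_stalkIdeal_of_ne_bot he_ii h𝓔0
  refine ⟨C, ?_, ?_, ?_, isEffectiveCartier_comap_subschemeι_of_frames hXreg 𝓔 C h𝓔C h𝓔cart he_iii hfr, ?_⟩
  · rw [hsup]; exact hCtr
  · rw [hsup]; exact hCflat
  · rw [hsup]; exact hCreg
  · rw [hsup]; exact hfr

set_option maxHeartbeats 400000 in
/-- **The embedded-lift round at the datum «`V(𝓔)` is `O`-flat», new AND old surface with the side facts of `K′`** — both Čech disjuncts of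
`TowerRound₄`/`TowerRound₅` (any full centre `Z` with `Z̃` regular of dimension 1 at closed points, `Ẽ` regular along it, `DirStepUnobs`), via
res-L1-w45b-stub-2's `Tower.inv₃_embRound_new/old` fed by `Tower.hCentre_of_fact_any`; the cone-witnessed shadow shape via res-D-pv-029's generic
cone-round bricks. [OURS · L1 W4.5b]; NOT a statement of the manuscript. -/
theorem Tower.inv₃_embRound_both_of_fact_any (O : Type) [CommRing O] [IsDomain O] [IsDiscreteValuationRing O] (k : Type) [Field k]
    (θ : O →+* k) (hθ : Function.Surjective θ)
    (P : Scheme.{0}) [IsIntegral P] (q : P ⟶ Spec (.of O)) [IsProper q] [SmoothOfRelativeDimension 3 q] (Y : Set P)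
    (hYsp : Y ⊆ q ⁻¹' {IsLocalRing.closedPoint O}) (hYirr : IsIrreducible Y) (hYcl : IsClosed Y)
    (hPnoeth : IsLocallyNoetherian P) (hPreg : Scheme.IsRegular P)
    (Ch : ∀ X' : Scheme.{0}, (X' ⟶ P) → Set X' → Prop)
    (hChStep : ∀ (X' X'' : Scheme.{0}) (σ' : X' ⟶ P) (S' : Set X') (C : X'.IdealSheafData) (τ : X'' ⟶ X'),
      Ch X' σ' S' → IsBlowup τ C → Scheme.IsRegular C.subscheme → Flat (C.subschemeι ≫ σ' ≫ q) →
      σ' '' (C.support : Set X') ⊆ {y | ¬ IsGenericPoint y Y} → (C.support : Set X') ∩ (σ' ≫ q) ⁻¹' {IsLocalRing.closedPoint O} ⊆ S' →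
      Ch X'' (τ ≫ σ') (closure (τ ⁻¹' (S' \ (C.support : Set X')))))
    (hChSplit : ∀ (X' : Scheme.{0}) (σ' : X' ⟶ P) (S' : Set X'), Ch X' σ' S' → Chain P Y X' σ' S')
    -- (T-k) the embedded-curve lift at every stage / exceptional surface over `q` (res-L1-w45b-lead-2 …NatTowerRoundFourDefs p594791)
    (hFact : EmbeddedCurveLift O k θ P q)
    -- (S7′) B9 at the `ConeForm` seed with the LOCALIZED shadow trace (vii-loc) (res-type-100: `…NatConeFormConstants` → KCL twin → `hBaseKCL`)
    : ∀ {F₉ : Scheme.{0}} (Z₉ : Set F₉) (hZ₉ : IsClosed Z₉) {F₁₀ : Scheme.{0}} (υ' : F₁₀ ⟶ F₉)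
    (G G' : Scheme.{0}) (γ : G ⟶ F₁₀) (T E K : Set G) (hE : IsClosed E) (Z : Set G) (hZ : IsClosed Z) (υ₂ : G' ⟶ G) (K' : Set G'),
    (Tower.Inv₃ O k θ P q Y Ch (fun _ _ _ _ _ _ _ _ _ σ _ 𝓔 => Flat (𝓔.subschemeι ≫ σ ≫ q)) F₉ Z₉ hZ₉ F₁₀ υ' G γ T E K ∧ IsClosed K ∧ K ⊆ closure (K \ E) ∧ K ≠ Set.univ) →
    Z ⊆ E ∩ T → Z.Nonempty → TowerFull F₉ F₁₀ υ' Z₉ hZ₉ G γ Z hZ →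
    (∀ x : redSub G Z hZ, IsRegularLocalRing ((redSub G Z hZ).presheaf.stalk x)) →
    (∀ (i : redSub G Z hZ ⟶ redSub G E hE), i ≫ redSubι G E hE = redSubι G Z hZ →
      ∀ x : redSub G Z hZ, IsRegularLocalRing ((redSub G E hE).presheaf.stalk (i x))) →
    DirStepUnobs G E hE Z hZ →
    (∀ z : ↥(redSub G Z hZ), IsClosed ({z} : Set ↥(redSub G Z hZ)) → ringKrullDim ((redSub G Z hZ).presheaf.stalk z) = ((1 : ℕ) : WithBot ℕ∞)) →
    IsBlowup υ₂ (vanishingIdeal (⟨Z, hZ⟩ : Closeds G)) →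
    (K' = ∅ ∨ ((ConeWitness G E hE K Z hZ ∨ closure (Z \ closure K) = Z) ∧ K' = closure (υ₂ ⁻¹' (K \ Z)))) →
    (Tower.Inv₃ O k θ P q Y Ch (fun _ _ _ _ _ _ _ _ _ σ _ 𝓔 => Flat (𝓔.subschemeι ≫ σ ≫ q)) F₉ Z₉ hZ₉ F₁₀ υ' G' (υ₂ ≫ γ) (closure (υ₂ ⁻¹' (T \ Z))) (υ₂ ⁻¹' Z) K' ∧
        IsClosed K' ∧ K' ⊆ closure (K' \ υ₂ ⁻¹' Z) ∧ K' ≠ Set.univ) ∧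
      (Tower.Inv₃ O k θ P q Y Ch (fun _ _ _ _ _ _ _ _ _ σ _ 𝓔 => Flat (𝓔.subschemeι ≫ σ ≫ q)) F₉ Z₉ hZ₉ F₁₀ υ' G' (υ₂ ≫ γ) (closure (υ₂ ⁻¹' (T \ Z))) (closure (υ₂ ⁻¹' (E \ Z))) K' ∧
        IsClosed K' ∧ K' ⊆ closure (K' \ closure (υ₂ ⁻¹' (E \ Z))) ∧ K' ≠ Set.univ) := by
  intro F₉ Z₉ hZ₉ F₁₀ υ' G G' γ T E K hE Z hZ υ₂ K' hI hZET hZne hfull hZreg hEZreg hunobs hZdim hυ₂ hK'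
  obtain ⟨hinv, hKcl, hKE, hKne⟩ := hI
  have hGint : IsIntegral G := hinv.2.2.1
  have hEcl : IsClosed E := hinv.2.2.2.2.2.1
  have hTE : ¬ T ⊆ E := hinv.2.2.2.2.2.2.1
  haveI := hGint
  have hZE : Z ⊆ E := fun z hz => (hZET hz).1
  have hTZ : ¬ T ⊆ Z := fun h => hTE (h.trans hZE)
  have hZsupp : ((vanishingIdeal (⟨Z, hZ⟩ : Closeds G) : G.IdealSheafData).support : Set G) = Z :=
    Scheme.IdealSheafData.coe_support_vanishingIdeal _
  -- the centre, the two shadow transports, the datum's birth / transport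
  have hEne : E ≠ Set.univ := fun h => hTE (h ▸ Set.subset_univ _)
  have hC := Tower.hCentre_of_fact_any O k θ hθ P q Y hYsp hYirr hYcl hPnoeth hPreg Ch hChStep hChSplit hFact Z₉ hZ₉ υ' G γ T E hE Z hZ hEne
    hZE hZreg hEZreg hunobs hZdim
  -- (N3-any)/(N3′-any) by res-D-pv-035's bricks
  have hS := Tower.hShadow_of_any O k θ hθ P q ‹IsProper q› Y hYirr hYcl hPnoeth hPreg Ch hChSplit ‹IsIntegral P› Z₉ hZ₉ υ' G G' γ T E K hE Z hZ
    υ₂ hυ₂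
  have hSo := Tower.hShadowOld_of_any O k θ hθ P q ‹IsProper q› Y hYirr hYcl hPnoeth hPreg Ch hChSplit ‹IsIntegral P› Z₉ hZ₉ υ' G G' γ T E K hE
    Z hZ υ₂ hυ₂
  have hBorn : ∀ (X : Scheme.{0}) (σ : X ⟶ P) (S : Set X) (jG : G ⟶ X) (tG : G ⟶ Spec (.of k)) (𝓔 𝒦₁ : X.IdealSheafData)
      (X'' : Scheme.{0}) (τ : X'' ⟶ X) (j₂ : G' ⟶ X'') (t₂ : G' ⟶ Spec (.of k)),
      Ch X σ S → IsIntegral X → IsLocallyNoetherian X → Scheme.IsRegular X → IsDominant (σ ≫ q) →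
      IsPullback jG tG (σ ≫ q) (Spec.map (CommRingCat.ofHom θ)) → jG '' T = S →
      (𝓔 ⊔ 𝒦₁).comap jG = vanishingIdeal ⟨Z, hZ⟩ → Flat ((𝓔 ⊔ 𝒦₁).subschemeι ≫ σ ≫ q) → Scheme.IsRegular (𝓔 ⊔ 𝒦₁).subscheme →
      Scheme.IsRegular 𝓔.subscheme → IsBlowup τ (𝓔 ⊔ 𝒦₁) → IsPullback j₂ t₂ ((τ ≫ σ) ≫ q) (Spec.map (CommRingCat.ofHom θ)) →
      j₂ ≫ τ = υ₂ ≫ jG →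
      Flat (((𝓔 ⊔ 𝒦₁).comap τ).subschemeι ≫ (τ ≫ σ) ≫ q) := by
    intro X σ S jG tG 𝓔 𝒦₁ X'' τ j₂ t₂ _ _ hXnoeth hXreg _ _ _ _ hc2 hc3 _ hτ _ _
    haveI := hXnoeth
    rw [Category.assoc]
    exact flat_exceptional_of_isBlowup_regularCentre O X X'' (σ ≫ q) (𝓔 ⊔ 𝒦₁) hXreg hc3 hc2 τ hτ
  have hMoved : ∀ (X : Scheme.{0}) (σ : X ⟶ P) (jG : G ⟶ X) (𝓔 𝒦₁ : X.IdealSheafData) (X'' : Scheme.{0}) (τ : X'' ⟶ X)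
      (j₂ : G' ⟶ X'') (t₂ : G' ⟶ Spec (.of k)),
      IsBlowup τ (𝓔 ⊔ 𝒦₁) → IsPullback j₂ t₂ ((τ ≫ σ) ≫ q) (Spec.map (CommRingCat.ofHom θ)) → j₂ ≫ τ = υ₂ ≫ jG →
      (𝓔 ⊔ 𝒦₁).comap jG = vanishingIdeal ⟨Z, hZ⟩ →
      (∃ e : (strictTransformIdeal τ (𝓔 ⊔ 𝒦₁) 𝓔).subscheme ≅ 𝓔.subscheme,
        e.hom ≫ 𝓔.subschemeι = (strictTransformIdeal τ (𝓔 ⊔ 𝒦₁) 𝓔).subschemeι ≫ τ) →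
      Flat (𝓔.subschemeι ≫ σ ≫ q) →
      Flat ((strictTransformIdeal τ (𝓔 ⊔ 𝒦₁) 𝓔).subschemeι ≫ (τ ≫ σ) ≫ q) := by
    intro X σ jG 𝓔 𝒦₁ X'' τ j₂ t₂ _ _ _ _ he hR
    obtain ⟨e, he⟩ := he
    have heq : (strictTransformIdeal τ (𝓔 ⊔ 𝒦₁) 𝓔).subschemeι ≫ (τ ≫ σ) ≫ q = e.hom ≫ 𝓔.subschemeι ≫ σ ≫ q := by
      rw [← Category.assoc e.hom, he]; simp only [Category.assoc]
    rw [heq]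
    infer_instance
  -- the two `Tower.Inv₃` conclusions, for the three admitted shapes of `K′`
  have hboth : Tower.Inv₃ O k θ P q Y Ch (fun _ _ _ _ _ _ _ _ _ σ _ 𝓔 => Flat (𝓔.subschemeι ≫ σ ≫ q)) F₉ Z₉ hZ₉ F₁₀ υ' G' (υ₂ ≫ γ) (closure (υ₂ ⁻¹' (T \ Z))) (υ₂ ⁻¹' Z) K' ∧
      Tower.Inv₃ O k θ P q Y Ch (fun _ _ _ _ _ _ _ _ _ σ _ 𝓔 => Flat (𝓔.subschemeι ≫ σ ≫ q)) F₉ Z₉ hZ₉ F₁₀ υ' G' (υ₂ ≫ γ) (closure (υ₂ ⁻¹' (T \ Z))) (closure (υ₂ ⁻¹' (E \ Z))) K' := by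
    rcases hK' with hK0 | ⟨hcase, hKst⟩
    · exact ⟨Tower.inv₃_embRound_new O k θ hθ P q Y hYirr hYcl hPnoeth hPreg Ch hChSplit hChStep (fun _ _ _ _ _ _ _ _ _ σ _ 𝓔 => Flat (𝓔.subschemeι ≫ σ ≫ q)) Z₉ hZ₉ υ' G G' γ T E K hE Z hZ υ₂
          hinv hZET hfull hυ₂ hKcl hKE hKne hC hS hBorn K' (Or.inl hK0),
        Tower.inv₃_embRound_old O k θ hθ P q Y hYirr hYcl hPnoeth hPreg Ch hChSplit hChStep (fun _ _ _ _ _ _ _ _ _ σ _ 𝓔 => Flat (𝓔.subschemeι ≫ σ ≫ q)) Z₉ hZ₉ υ' G G' γ T E K hE Z hZ υ₂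
          hinv hZET hfull hυ₂ hKcl hKE hKne hC hSo hMoved K' (Or.inl hK0)⟩
    · rcases hcase with hcone | hoff
      · -- cone-witnessed as well: res-D-pv-029's GENERIC cone-round bricks at the datum `FE`
        have hK'' : K' = ∅ ∨ K' = closure (υ₂ ⁻¹' (K \ Z)) := Or.inr hKst
        exact ⟨Tower.inv₃_coneRound_new O k θ hθ P q Y hYirr hYcl hPnoeth hPreg Ch hChSplit hChStep (fun _ _ _ _ _ _ _ _ _ σ _ 𝓔 => Flat (𝓔.subschemeι ≫ σ ≫ q)) Z₉ hZ₉ υ' G G' γ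
            T E K hE Z hZ υ₂ hinv hZET hZne hfull hcone hυ₂ hKcl hKE hKne
            hBorn K' hK'',
          Tower.inv₃_coneRound_old O k θ hθ P q Y hYirr hYcl hPnoeth hPreg Ch hChSplit hChStep (fun _ _ _ _ _ _ _ _ _ σ _ 𝓔 => Flat (𝓔.subschemeι ≫ σ ≫ q)) Z₉ hZ₉ υ' G G' γ
            T E K hE Z hZ υ₂ hinv hZET hZne hfull hcone hυ₂ hKcl hKE
            (Tower.subset_closure_diff_of_inv₃_coneWitness O k θ hθ P q Y Ch (fun _ _ _ _ _ _ _ _ _ σ _ 𝓔 => Flat (𝓔.subschemeι ≫ σ ≫ q)) Z₉ hZ₉ υ' G γ T E K hE Z hZ hinv hfull hZE hcone)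
            hMoved K' hK''⟩
      · exact ⟨Tower.inv₃_embRound_new O k θ hθ P q Y hYirr hYcl hPnoeth hPreg Ch hChSplit hChStep (fun _ _ _ _ _ _ _ _ _ σ _ 𝓔 => Flat (𝓔.subschemeι ≫ σ ≫ q)) Z₉ hZ₉ υ' G G' γ T E K hE Z hZ υ₂
            hinv hZET hfull hυ₂ hKcl hKE hKne hC hS hBorn K' (Or.inr ⟨hoff, hKst⟩),
          Tower.inv₃_embRound_old O k θ hθ P q Y hYirr hYcl hPnoeth hPreg Ch hChSplit hChStep (fun _ _ _ _ _ _ _ _ _ σ _ 𝓔 => Flat (𝓔.subschemeι ≫ σ ≫ q)) Z₉ hZ₉ υ' G G' γ T E K hE Z hZ υ₂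
            hinv hZET hfull hυ₂ hKcl hKE hKne hC hSo hMoved K' (Or.inr ⟨hoff, hKst⟩)⟩
  obtain ⟨hnew, hold⟩ := hboth
  have hG'int : IsIntegral G' := hnew.2.2.1
  haveI := hG'int
  rcases hK' with rfl | ⟨-, rfl⟩
  · exact ⟨⟨hnew, isClosed_empty, Set.empty_subset _, Set.empty_ne_univ⟩, ⟨hold, isClosed_empty, Set.empty_subset _, Set.empty_ne_univ⟩⟩
  · have hne : closure (υ₂ ⁻¹' (K \ Z)) ≠ Set.univ :=
      closure_preimage_ne_univ υ₂ _ hυ₂ K Z hKcl hKne hZ (fun h => hTZ (h ▸ Set.subset_univ _)) hZsupp.le _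
        (Set.preimage_mono fun z hz => hz.1)
    refine ⟨⟨hnew, isClosed_closure, closure_preimage_diff_subset_closure_diff_preimage υ₂ K Z, hne⟩,
      ⟨hold, isClosed_closure, ?_, hne⟩⟩
    have h := closure_preimage_diff_subset_of_isBlowup υ₂ (vanishingIdeal (⟨Z, hZ⟩ : Closeds G)) hυ₂ K E hEcl hKE
    rw [hZsupp] at h
    exact h


/-- **The carrier stage is locally Noetherian** (from the inner invariant's model square: a closed subscheme of a locally Noetherian stage).
[OURS · elementary]; NOT a statement of the manuscript. -/
theorem Tower.isLocallyNoetherian_of_innerInv (O : Type) [CommRing O] [IsDomain O] [IsDiscreteValuationRing O] (k : Type) [Field k]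
    (θ : O →+* k) (hθ : Function.Surjective θ) (P : Scheme.{0}) (q : P ⟶ Spec (.of O)) (Y : Set P)
    (Ch : ∀ X' : Scheme.{0}, (X' ⟶ P) → Set X' → Prop) {F₁ F₂ : Scheme.{0}} :
    ∀ (W : Set F₁) {F₉ : Scheme.{0}} (β₉ : F₉ ⟶ F₂) (T₉ Z₉ K₉ : Set F₉) (b₉ : Bool),
    ((K₉ = ∅ ∧ TCPlus.Inv O k θ P q Y Ch W F₉ β₉ T₉ Z₉ b₉) ∨
      (TCPlus.InvKCL O k θ P q Y Ch W F₉ β₉ T₉ Z₉ K₉ b₉ ∧ IsClosed K₉ ∧ K₉ ⊆ closure (K₉ \ closure Z₉) ∧ K₉ ≠ Set.univ ∧ IsClosed Z₉)) →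
    IsLocallyNoetherian F₉ := by
  intro W F₉ β₉ T₉ Z₉ K₉ b₉ hI
  haveI : IsClosedImmersion (Spec.map (CommRingCat.ofHom θ)) := IsClosedImmersion.spec_of_surjective _ hθ
  rcases hI with ⟨-, -, -, -, -, hmem, -⟩ | ⟨⟨-, -, -, -, hmem, -⟩, -⟩
  · obtain ⟨X, σ, S, jG, tG, 𝓢, K, -, -, hXnoeth, -, -, hsqG, -⟩ := hmem
    haveI := hXnoeth
    haveI : IsClosedImmersion jG := MorphismProperty.IsStableUnderBaseChange.of_isPullback hsqG.flip inferInstance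
    exact LocallyOfFiniteType.isLocallyNoetherian jG
  · obtain ⟨X, σ, S, jG, tG, 𝓢, K, -, -, hXnoeth, -, -, hsqG, -⟩ := hmem
    haveI := hXnoeth
    haveI : IsClosedImmersion jG := MorphismProperty.IsStableUnderBaseChange.of_isPullback hsqG.flip inferInstance
    exact LocallyOfFiniteType.isLocallyNoetherian jG

end Summit.ResolutionOfSingularities.ResolutionOfSingularities.Cruxes.EquisingularLiftNat.Sections

end
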